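/-
Copyright (c) 2026 the pub-hodgecm-mathlib formalisation cell (harness21).  Prover seat hodgecm-mathlib-K2Liu-p09 (g2): Track B «K2-LIT», #184♮ = hLiu418,
payer-internal steps (ae)+(u) of file #34 `Theorems/K2LiuDoublingZetaGL1.lean` on top of ★ #13 (LEAD F0P6-plan (g10) DEAL K2/STATUS 2026-09-04T02:36:29Z;
DEPMAP v2.5 §8 (u)(ae), §10 TABLE B rows `w`, `w'`, «the identity»).
-/
import Literature.NumberTheory.K2Lit.DoublingZetaIntegral
import Summits.HodgeConjecture.HodgeConjecture.Theorems.K2LiuDoublingUnfold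
import Summits.HodgeConjecture.HodgeConjecture.Theorems.K2LiuDoublingUnfoldTwist
import Summits.HodgeConjecture.HodgeConjecture.Theorems.K2LiuDoublingZetaGL1Prelim
import HarnessLib

/-!
# Crux `HLiu418`, Track B road `K2_Liu`, file #34 — steps (ae)+(u) on ★ #13: UNFOLDING WITH `L²` SLOTS AND THE `s`-TWIST CANCELLED

Cell `hodgecm-mathlib`, crux item hLiu418 = `stmt-HodgeConjecture-24832`, route of record `HCCMUnconditional`; squad K2 ∕ K2Liu, LEAD F0P6-plan (g10),
prover K2Liu-p09 (g2).  THEOREMS ONLY (no `def`, no instance, no notation, no named-fact hypothesis, no `sorry`, default heartbeats); lane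
`--supports stmt-HodgeConjecture-24832 --as helper` (count-neutral).

s23's left side is `doublingPairing μ (E(f_s) ∘ ι ∘ (ιA × ιA)) w (twistD_s · w')` with `w, w'` the `L²` CLASSES of two vectors of `π_P` (a.e.-defined
functions) and the `s`-dependent unitary twist `twistD_s(x) = χ_s(ι(ιA (out x)⁻¹, ιA (out x)⁻¹))`; ★ #13 `K2LiuDoublingUnfold.doublingUnfold` unfolds
`doublingPairing μ (…) φ₁ φ₂` for CONTINUOUS slots into `doublingZeta ν μ ιA f φ₁ (conj twistD_s · φ₂)`.  This file packages the two
bookkeeping steps between them, once, in ★ #13's own frame: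
* §1 `doublingPairing_congr_ae` — the doubling pairing sees its two slots only through their `μ`-a.e. classes (`μ ⊗ μ`-null cylinders);
* §2 `norm_twist_eq_one` — `|twistD_s(x)| = 1` for unitary `χ` (★ `siegelDeltaCharacter_iotaV_diag`: the value is `χ(det(a ⊗ 1))`);
* §3 `doublingUnfold_ae_twist` — **★ #13 with `L²` slots and the twist cancelled**: for `w =ᵐ wc`, `w' =ᵐ wc'` (`wc, wc'` continuous, majorant
  integrable) `doublingPairing μ (E(f)∘ι) w (twistD_s · w') = doublingZeta ν μ ιA f wc wc'` and `DoublingZetaConverges ν μ ιA f wc wc'` — the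
  input line of ★ #29s `doublingPartialEuler` with the `s`-FREE slots `wc, wc'` (so that ★ #32s ∕ #33s apply to `s`-independent data).

HONEST LABEL: HC_CM is proved only modulo the printed citations (2 remaining named inputs: hLiu418 = stmt-HodgeConjecture-24832,
h413 = stmt-HodgeConjecture-24833) until rung 0 closes; this file is bookkeeping toward socket s23 and closes no item.
-/

set_option autoImplicit false
set_option linter.dupNamespace false

noncomputable section

open scoped Matrix ENNReal ComplexConjugate
open NumberField IsDedekindDomain MeasureTheory
open Literature.NumberTheory.Automorphic Literature.NumberTheory.GaloisRepresentations
open Literature.NumberTheory.GelbartRogawski1991 Literature.NumberTheory.GelbartRogawski1991.GRConstruction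
open Literature.NumberTheory.K2Lit.SiegelDoubled
open Literature.NumberTheory.Automorphic.UnitaryGroup (adelicGroupData adelicVal)
open Literature.AlgebraicGeometry.ShimuraVarieties (hermForm)

namespace Summit.HodgeConjecture.HodgeConjecture.Cruxes.HLiu418.K2LiuDoublingZetaGL1Unfold

/-! ## §1 The doubling pairing sees its slots only a.e. -/

section Generic

variable {K : Type} [Field K] [NumberField K] (𝒢 : AdelicGroupData.{0} K) (μ : Measure 𝒢.automorphicQuotient)

/-- `doublingPairing μ Eq φ₁ φ₂` depends on `φ₁, φ₂` only through their `μ`-a.e. classes (the cylinders over `μ`-null sets are `μ ⊗ μ`-null: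
Mathlib `quasiMeasurePreserving_fst ∕ _snd`). [cite: Liu2021, Lem. B.11 p. 102] -/
theorem doublingPairing_congr_ae (Eq : 𝒢.automorphicQuotient × 𝒢.automorphicQuotient → ℂ)
    {φ₁ φ₁' φ₂ φ₂' : 𝒢.automorphicQuotient → ℂ} (h₁ : φ₁ =ᵐ[μ] φ₁') (h₂ : φ₂ =ᵐ[μ] φ₂') :
    doublingPairing 𝒢 μ Eq φ₁ φ₂ = doublingPairing 𝒢 μ Eq φ₁' φ₂' := by
  unfold doublingPairing
  refine integral_congr_ae ?_
  have h₁' : (fun x : 𝒢.automorphicQuotient × 𝒢.automorphicQuotient => φ₁ x.1) =ᵐ[μ.prod μ] fun x => φ₁' x.1 :=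
    (Measure.quasiMeasurePreserving_fst (μ := μ) (ν := μ)).ae_eq_comp h₁
  have h₂' : (fun x : 𝒢.automorphicQuotient × 𝒢.automorphicQuotient => φ₂ x.2) =ᵐ[μ.prod μ] fun x => φ₂' x.2 :=
    (Measure.quasiMeasurePreserving_snd (μ := μ) (ν := μ)).ae_eq_comp h₂
  filter_upwards [h₁', h₂'] with x hx1 hx2
  rw [hx1, hx2]

end Generic

/-! ## §2 The twist has absolute value one -/

section Twist

variable (L : Type) [Field L] [NumberField L] [IsCMField L]
variable {N M n : ℕ} (e : Fin N × Fin M ≃ Fin n)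
  (dV : Fin N → L) (hdV : ∀ i, IsCMField.complexConj L (dV i) = dV i) (hdV0 : ∀ i, dV i ≠ 0)
  (dW : Fin M → L) (hdW : ∀ i, IsCMField.complexConj L (dW i) = dW i) (hdW0 : ∀ i, dW i ≠ 0)

include hdV0 hdW0 in
/-- `|χ_s(ι(a, a))| = 1` for unitary `χ`: the value is `χ(det(a ⊗ 1))` (★ `K2LiuDoublingUnfoldTwist.siegelDeltaCharacter_iotaV_diag`).
[cite: HarrisKudlaSweet1996, §1 (1.11)–(1.15)] -/
theorem norm_twist_eq_one (χ : HeckeCharacter L) (hχ : χ.IsUnitary) (s : ℂ)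
    (a : UnitaryGroup.adelic (Fp L) L (IsCMField.complexConj L) N (Matrix.diagonal dV)) :
    ‖siegelDeltaCharacter L e dV hdV dW hdW χ s (iotaV L e dV hdV dW hdW (a, a))‖ = 1 := by
  rw [K2LiuDoublingUnfoldTwist.siegelDeltaCharacter_iotaV_diag L e dV hdV hdV0 dW hdW hdW0 χ s a]
  exact hχ _

end Twist

/-! ## §3 ★ #13 with `L²` slots and the twist cancelled -/

/-- **Unfolding with `L²` slots, twist cancelled.**  In ★ #13's frame (`W` of rank `1`, anisotropic `H`, docking pin `hιA`): there is a Haar measure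
`ν` on `G(𝔸)` such that for every UNITARY `χ`, every `s`, every continuous Siegel section `f` at `(χ, s)` with summable Eisenstein series, and all
slots `w =ᵐ wc`, `w' =ᵐ wc'` with `wc, wc'` continuous and the `E(|f|)`-majorant integrable on `[G] × [G]`:
`DoublingZetaConverges ν μ ιA f wc wc'` and `doublingPairing μ (E(f)∘ι∘(ιA×ιA)) w (twistD_s · w') = doublingZeta ν μ ιA f wc wc'`.
(★ #13 at `(wc, twistD_s · wc')`; the slots are replaced a.e. by §1; ★ #13's conjugate twist cancels `twistD_s` by §2 and ★
`K2LiuDoublingZetaGL1Prelim.conj_mul_mul_of_norm_eq_one`.) [cite: Liu2021, Lem. B.11 p. 102] -/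
theorem doublingUnfold_ae_twist :
    ∀ (L : Type) [Field L] [NumberField L] [IsCMField L] {N n : ℕ} (e : Fin N × Fin 1 ≃ Fin n)
      (H : Matrix (Fin N) (Fin N) L)
      (dV : Fin N → L) (hdV : ∀ i, IsCMField.complexConj L (dV i) = dV i)
      (dW : Fin 1 → L) (hdW : ∀ i, IsCMField.complexConj L (dW i) = dW i)
      (_hdV0 : ∀ i, dV i ≠ 0) (_hdW0 : ∀ i, dW i ≠ 0)
      (t : L) (_ht : t ≠ 0) (g : GL (Fin N) L)
      (_hg : formCongr ((IsCMField.complexConj L : L ≃ₐ[↥(maximalRealSubfield L)] L) : L →+* L) g (t • H) = Matrix.diagonal dV)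
      (_hanis : ∀ x : Fin N → L, hermForm (cmConjRingHom L) H x x = 0 → x = 0)
      (μ : Measure (adelicGroupData (↥(maximalRealSubfield L)) L (IsCMField.complexConj L) N H).automorphicQuotient)
      [(adelicGroupData (↥(maximalRealSubfield L)) L (IsCMField.complexConj L) N H).IsAutomorphicMeasure μ]
      (ιA : (adelicGroupData (↥(maximalRealSubfield L)) L (IsCMField.complexConj L) N H).Adelic →*
        ↥(UnitaryGroup.adelic (↥(maximalRealSubfield L)) L (IsCMField.complexConj L) N (Matrix.diagonal dV))),
      (∀ k, ((ιA k : ↥(UnitaryGroup.adelic (↥(maximalRealSubfield L)) L (IsCMField.complexConj L) N (Matrix.diagonal dV))) :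
            GL (Fin N) (AdeleRing (𝓞 L) L)) =
          (toAdeleGL L g)⁻¹ * adelicVal (↥(maximalRealSubfield L)) L (IsCMField.complexConj L) N H k * toAdeleGL L g) →
      ∀ [CompactSpace (adelicGroupData (↥(maximalRealSubfield L)) L (IsCMField.complexConj L) N H).automorphicQuotient]
        [MeasurableSpace (adelicGroupData (↥(maximalRealSubfield L)) L (IsCMField.complexConj L) N H).Adelic]
        [BorelSpace (adelicGroupData (↥(maximalRealSubfield L)) L (IsCMField.complexConj L) N H).Adelic],
      ∃ ν : Measure (adelicGroupData (↥(maximalRealSubfield L)) L (IsCMField.complexConj L) N H).Adelic, ν.IsHaarMeasure ∧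
        ∀ (χ : HeckeCharacter L), χ.IsUnitary → ∀ (s : ℂ) (f : HA L e dV hdV dW hdW → ℂ),
          IsSiegelDeltaSection L e dV hdV dW hdW χ s f → Continuous f →
          (∀ h : HA L e dV hdV dW hdW, Summable fun q : SiegelDeltaQuot L e dV hdV dW hdW =>
              ‖f (((Quotient.out q : ratH L e dV hdV dW hdW) : HA L e dV hdV dW hdW) * h)‖) →
          ∀ (w w' wc wc' : (adelicGroupData (↥(maximalRealSubfield L)) L (IsCMField.complexConj L) N H).automorphicQuotient → ℂ),
            w =ᵐ[μ] wc → w' =ᵐ[μ] wc' → Continuous wc → Continuous wc' →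
            Integrable (fun x : (adelicGroupData (↥(maximalRealSubfield L)) L (IsCMField.complexConj L) N H).automorphicQuotient ×
                  (adelicGroupData (↥(maximalRealSubfield L)) L (IsCMField.complexConj L) N H).automorphicQuotient =>
                ‖toQuotFun₂ (adelicGroupData (↥(maximalRealSubfield L)) L (IsCMField.complexConj L) N H)
                    (eisensteinPullback L e dV hdV dW hdW
                      (adelicGroupData (↥(maximalRealSubfield L)) L (IsCMField.complexConj L) N H) ιA
                      (fun h => ((‖f h‖ : ℝ) : ℂ))) x‖ * ‖wc x.1‖ * ‖wc' x.2‖) (μ.prod μ) →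
            DoublingZetaConverges L e dV hdV dW hdW (adelicGroupData (↥(maximalRealSubfield L)) L (IsCMField.complexConj L) N H)
                ν μ ιA f wc wc' ∧
              doublingPairing (adelicGroupData (↥(maximalRealSubfield L)) L (IsCMField.complexConj L) N H) μ
                  (toQuotFun₂ (adelicGroupData (↥(maximalRealSubfield L)) L (IsCMField.complexConj L) N H)
                    (eisensteinPullback L e dV hdV dW hdW
                      (adelicGroupData (↥(maximalRealSubfield L)) L (IsCMField.complexConj L) N H) ιA f)) w
                  (fun x => siegelDeltaCharacter L e dV hdV dW hdW χ s
                    (iotaV L e dV hdV dW hdW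
                      (ιA ((Quotient.out (x : (adelicGroupData (↥(maximalRealSubfield L)) L (IsCMField.complexConj L) N H).Adelic ⧸
                          (adelicGroupData (↥(maximalRealSubfield L)) L (IsCMField.complexConj L) N H).quotientSubgroup)) :
                          (adelicGroupData (↥(maximalRealSubfield L)) L (IsCMField.complexConj L) N H).Adelic)⁻¹,
                       ιA ((Quotient.out (x : (adelicGroupData (↥(maximalRealSubfield L)) L (IsCMField.complexConj L) N H).Adelic ⧸
                          (adelicGroupData (↥(maximalRealSubfield L)) L (IsCMField.complexConj L) N H).quotientSubgroup)) :
                          (adelicGroupData (↥(maximalRealSubfield L)) L (IsCMField.complexConj L) N H).Adelic)⁻¹)) * w' x) =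
                doublingZeta L e dV hdV dW hdW (adelicGroupData (↥(maximalRealSubfield L)) L (IsCMField.complexConj L) N H)
                  ν μ ιA f wc wc' := by
  intro L _ _ _ N n e H dV hdV dW hdW hdV0 hdW0 t ht g hg hanis μ _ ιA hιA _ _ _
  obtain ⟨ν, hν, h13⟩ :=
    K2LiuDoublingUnfold.doublingUnfold L e H dV hdV dW hdW hdV0 hdW0 t ht g hg hanis μ ιA hιA
  refine ⟨ν, hν, ?_⟩
  intro χ hχ s f hf hfc hsum w w' wc wc' hw hw' hwc hwc' hmaj
  -- the twist: absolute value one, continuous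
  have htw1 : ∀ x : (adelicGroupData (↥(maximalRealSubfield L)) L (IsCMField.complexConj L) N H).automorphicQuotient,
      ‖siegelDeltaCharacter L e dV hdV dW hdW χ s
                    (iotaV L e dV hdV dW hdW
                      (ιA ((Quotient.out (x : (adelicGroupData (↥(maximalRealSubfield L)) L (IsCMField.complexConj L) N H).Adelic ⧸
                          (adelicGroupData (↥(maximalRealSubfield L)) L (IsCMField.complexConj L) N H).quotientSubgroup)) :
                          (adelicGroupData (↥(maximalRealSubfield L)) L (IsCMField.complexConj L) N H).Adelic)⁻¹,
                       ιA ((Quotient.out (x : (adelicGroupData (↥(maximalRealSubfield L)) L (IsCMField.complexConj L) N H).Adelic ⧸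
                          (adelicGroupData (↥(maximalRealSubfield L)) L (IsCMField.complexConj L) N H).quotientSubgroup)) :
                          (adelicGroupData (↥(maximalRealSubfield L)) L (IsCMField.complexConj L) N H).Adelic)⁻¹))‖ = 1 :=
    fun x => norm_twist_eq_one L e dV hdV hdV0 dW hdW hdW0 χ hχ s _
  have htwc : Continuous fun x : (adelicGroupData (↥(maximalRealSubfield L)) L (IsCMField.complexConj L) N H).automorphicQuotient =>
      siegelDeltaCharacter L e dV hdV dW hdW χ s
                    (iotaV L e dV hdV dW hdW
                      (ιA ((Quotient.out (x : (adelicGroupData (↥(maximalRealSubfield L)) L (IsCMField.complexConj L) N H).Adelic ⧸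
                          (adelicGroupData (↥(maximalRealSubfield L)) L (IsCMField.complexConj L) N H).quotientSubgroup)) :
                          (adelicGroupData (↥(maximalRealSubfield L)) L (IsCMField.complexConj L) N H).Adelic)⁻¹,
                       ιA ((Quotient.out (x : (adelicGroupData (↥(maximalRealSubfield L)) L (IsCMField.complexConj L) N H).Adelic ⧸
                          (adelicGroupData (↥(maximalRealSubfield L)) L (IsCMField.complexConj L) N H).quotientSubgroup)) :
                          (adelicGroupData (↥(maximalRealSubfield L)) L (IsCMField.complexConj L) N H).Adelic)⁻¹)) := by
    have h := Complex.continuous_conj.comp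
      (K2LiuDoublingUnfoldTwist.continuous_twist L e H dV hdV hdV0 dW hdW hdW0 t ht g hg ιA hιA χ s)
    refine h.congr fun x => ?_
    simp only [Function.comp_apply, Complex.conj_conj]
  have hφ₂c : Continuous fun x : (adelicGroupData (↥(maximalRealSubfield L)) L (IsCMField.complexConj L) N H).automorphicQuotient =>
      siegelDeltaCharacter L e dV hdV dW hdW χ s
                    (iotaV L e dV hdV dW hdW
                      (ιA ((Quotient.out (x : (adelicGroupData (↥(maximalRealSubfield L)) L (IsCMField.complexConj L) N H).Adelic ⧸
                          (adelicGroupData (↥(maximalRealSubfield L)) L (IsCMField.complexConj L) N H).quotientSubgroup)) :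
                          (adelicGroupData (↥(maximalRealSubfield L)) L (IsCMField.complexConj L) N H).Adelic)⁻¹,
                       ιA ((Quotient.out (x : (adelicGroupData (↥(maximalRealSubfield L)) L (IsCMField.complexConj L) N H).Adelic ⧸
                          (adelicGroupData (↥(maximalRealSubfield L)) L (IsCMField.complexConj L) N H).quotientSubgroup)) :
                          (adelicGroupData (↥(maximalRealSubfield L)) L (IsCMField.complexConj L) N H).Adelic)⁻¹)) * wc' x := htwc.mul hwc'
  -- the majorant with the twisted slot equals the majorant with `wc'`
  have hmaj' : Integrable (fun x : (adelicGroupData (↥(maximalRealSubfield L)) L (IsCMField.complexConj L) N H).automorphicQuotient ×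
        (adelicGroupData (↥(maximalRealSubfield L)) L (IsCMField.complexConj L) N H).automorphicQuotient =>
      ‖toQuotFun₂ (adelicGroupData (↥(maximalRealSubfield L)) L (IsCMField.complexConj L) N H)
          (eisensteinPullback L e dV hdV dW hdW
            (adelicGroupData (↥(maximalRealSubfield L)) L (IsCMField.complexConj L) N H) ιA
            (fun h => ((‖f h‖ : ℝ) : ℂ))) x‖ * ‖wc x.1‖ *
        ‖(fun x : (adelicGroupData (↥(maximalRealSubfield L)) L (IsCMField.complexConj L) N H).automorphicQuotient =>
            siegelDeltaCharacter L e dV hdV dW hdW χ s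
                    (iotaV L e dV hdV dW hdW
                      (ιA ((Quotient.out (x : (adelicGroupData (↥(maximalRealSubfield L)) L (IsCMField.complexConj L) N H).Adelic ⧸
                          (adelicGroupData (↥(maximalRealSubfield L)) L (IsCMField.complexConj L) N H).quotientSubgroup)) :
                          (adelicGroupData (↥(maximalRealSubfield L)) L (IsCMField.complexConj L) N H).Adelic)⁻¹,
                       ιA ((Quotient.out (x : (adelicGroupData (↥(maximalRealSubfield L)) L (IsCMField.complexConj L) N H).Adelic ⧸
                          (adelicGroupData (↥(maximalRealSubfield L)) L (IsCMField.complexConj L) N H).quotientSubgroup)) :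
                          (adelicGroupData (↥(maximalRealSubfield L)) L (IsCMField.complexConj L) N H).Adelic)⁻¹)) * wc' x) x.2‖) (μ.prod μ) := by
    refine hmaj.congr (Filter.Eventually.of_forall fun x => ?_)
    simp only [norm_mul, htw1, one_mul]
  obtain ⟨hconv, hid⟩ := h13 χ s f hf hfc hsum wc _ hwc hφ₂c hmaj'
  -- cancel the twist: `conj(tw) * (tw * wc') = wc'`
  have hpt : ∀ x : (adelicGroupData (↥(maximalRealSubfield L)) L (IsCMField.complexConj L) N H).automorphicQuotient,
      starRingEnd ℂ (siegelDeltaCharacter L e dV hdV dW hdW χ s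
                    (iotaV L e dV hdV dW hdW
                      (ιA ((Quotient.out (x : (adelicGroupData (↥(maximalRealSubfield L)) L (IsCMField.complexConj L) N H).Adelic ⧸
                          (adelicGroupData (↥(maximalRealSubfield L)) L (IsCMField.complexConj L) N H).quotientSubgroup)) :
                          (adelicGroupData (↥(maximalRealSubfield L)) L (IsCMField.complexConj L) N H).Adelic)⁻¹,
                       ιA ((Quotient.out (x : (adelicGroupData (↥(maximalRealSubfield L)) L (IsCMField.complexConj L) N H).Adelic ⧸
                          (adelicGroupData (↥(maximalRealSubfield L)) L (IsCMField.complexConj L) N H).quotientSubgroup)) :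
                          (adelicGroupData (↥(maximalRealSubfield L)) L (IsCMField.complexConj L) N H).Adelic)⁻¹))) *
        (siegelDeltaCharacter L e dV hdV dW hdW χ s
                    (iotaV L e dV hdV dW hdW
                      (ιA ((Quotient.out (x : (adelicGroupData (↥(maximalRealSubfield L)) L (IsCMField.complexConj L) N H).Adelic ⧸
                          (adelicGroupData (↥(maximalRealSubfield L)) L (IsCMField.complexConj L) N H).quotientSubgroup)) :
                          (adelicGroupData (↥(maximalRealSubfield L)) L (IsCMField.complexConj L) N H).Adelic)⁻¹,
                       ιA ((Quotient.out (x : (adelicGroupData (↥(maximalRealSubfield L)) L (IsCMField.complexConj L) N H).Adelic ⧸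
                          (adelicGroupData (↥(maximalRealSubfield L)) L (IsCMField.complexConj L) N H).quotientSubgroup)) :
                          (adelicGroupData (↥(maximalRealSubfield L)) L (IsCMField.complexConj L) N H).Adelic)⁻¹)) * wc' x) = wc' x :=
    fun x => K2LiuDoublingZetaGL1Prelim.conj_mul_mul_of_norm_eq_one (htw1 x) (wc' x)
  simp only [hpt] at hconv hid
  refine ⟨hconv, ?_⟩
  rw [← hid]
  -- replace the `L²` slots by their continuous companions (a.e.)
  exact doublingPairing_congr_ae (adelicGroupData (↥(maximalRealSubfield L)) L (IsCMField.complexConj L) N H) μ _ hw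
    (by filter_upwards [hw'] with x hx; rw [hx])

end Summit.HodgeConjecture.HodgeConjecture.Cruxes.HLiu418.K2LiuDoublingZetaGL1Unfold

end
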